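import Literature.NumberTheory.GaloisCohomology.Howard2004.DVRSettingEngineRedProofs
import Literature.NumberTheory.GaloisCohomology.Howard2004.DVRKolyvaginBoundLevelwisePackageProofs
import HarnessLib

/-!
# Howard 2004, Lemma 1.6.4 on a `DVRSetting`: the ENGINE instantiated — `κ^{(k)}_n ∈ Stub^{(k)}(n)` for every
# `n ∈ 𝓝(𝓛^{(2k-1)})` from the seven printed inputs stated in the cell's data currency (theorems only)

B. Howard, *The Heegner point Kolyvagin system*, Compositio Math. **140** (2004) (arXiv:1202.6340), Lemma 1.6.4 (arXiv
Lemma 2.6.4, p. 11 L82 – p. 12 L27).  The cell's ENGINE (`StubLemmaInductionProofs`, x10b-p1-w2 g15; guarded form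
`mem_stub_of_stubLemmaInduction_levels_guarded`, LEAD g12) is Howard's double induction over ABSTRACT data; the data
layer (`DVRSettingEngineData/Kappa/Stub`, `DVRSettingEngineRedProofs`) fixes the data on a `DVRSetting` `S` with
H.0–H.5: `H k n = H¹_{F(n)}(K,T^{(k)})` (`selmerModuleAt`), `loc = loc_ℓ` (`locR`), `κ k n = kappaSel`, `P k = 𝓛^{(2k-1)}`
(`enginePrimes`), `Stub/λ` from a levelwise decomposition (`stub`, `stubLength`), `red = redSel`; `htors` and `hred`
are discharged (`exists_pow_smul_eq_zero_selmerModuleAt`, `hred_kappaSel`).  THIS FILE plugs them in: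

* §0 `SelmerTriple.atLevel_empty_cond` — `F(1) = F` (tree `SelmerStructure.modify_empty`).
* §1 **`DVRSetting.kappaSel_mem_stub_of_engineInputs`** — `κ^{(k)}_n ∈ Stub^{(k)}(n)` for all `k` and
  `n ∈ 𝓝(𝓛^{(2k-1)})`, from the REMAINING printed inputs as hypotheses IN THE INSTANTIATED SHAPES (one brick each on
  the cell's board: `hlam` (package algebra + Lemma 1.3.3), `hlift` (Lemma 1.6.3 + liftability), `hKS` (display (ks)),
  `h159` (Prop. 1.5.9), `hsmall` (H.5 application), `hchebI/II` (Lemma 1.6.2 + parity), with abstract eigen-counts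
  `ρp ρm` and level-of-vanishing letter `lam`).
* §2 the empty level: `kappaR_empty` (`κ^{(k)}_1 = κ_1^{(k)}`: `κ_one` + the empty tensor `⊗_{q∈∅} ḡ_q = 1 ∈ G_1 = ℤ`
  + uniqueness `eq_kappaR_of_tmul_eq`), `selmerGroup_atLevel_empty`, `exists_dec_cond_of_dec_atLevel_empty`
  (transport along `F(1) = F`), `exists_dec_stubLength_eq` (the chosen decomposition behind `λ^{(k)}(n)`),
  **`exists_one_eq_scalarMapH1_of_kappaSel_empty_mem_stub`** (Lemma 1.6.4 at `n = 1`: `κ_1^{(k)} = π^{λ^{(k)}(1)} · y`).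
* §3 **`conclusion_of_kappaSel_empty_mem_stub`** (`S.Conclusion hy κ.one` from `∀ k, κ^{(k)}_1 ∈ Stub^{(k)}(1)` via the
  package route `conclusion_of_levelwise_package` with the chosen decompositions) and
  **`DVRSetting.conclusion_of_engineInputs`** — `S.Conclusion hy κ.one` (Thm. 1.6.1's conclusion record) for ANY
  `DVRSetting` with H.0–H.5 and `κ_1 ≠ 0` from `HasLevelDecompositions` + the seven engine inputs (§1 at `n = 1`, §2, §3).
  (The «for EVERY decomposition» form of Lemma 1.6.4 at `n = 1` follows with
  `epsilon_eq_and_length_eq_of_two_decompositions`; not needed on this route.)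

THEOREMS ONLY; no definition, no named fact, no instance, no `sorry`.  `thm161_dvrKolyvaginBound` is NOT proved here (the
seven inputs and the levelwise structure remain hypotheses); BSD is not proved by any of this.
-/

set_option autoImplicit false

noncomputable section

open Function NumberField IsDedekindDomain Field
open scoped NumberField ContRepresentation Classical

namespace Literature.NumberTheory.GaloisCohomology.Howard2004

open Literature.NumberTheory.GaloisRepresentations
open Literature.NumberTheory.GaloisRepresentations.DiscreteGaloisModule

/-! ## §0 `F(1) = F`: the level Selmer triple at the empty level -/

namespace SelmerTriple

variable {p : ℕ} [Fact p.Prime] {K : Type} [Field K] [NumberField K]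
  {M : Type} [AddCommGroup M] [TopologicalSpace M] [DiscreteTopology M]

/-- **`F(1) = F`**: at the empty level the modified Selmer structure `F(n)` is `F` itself («if any of `a, b, c`
are `1` they shall be excluded from the notation»; tree `SelmerStructure.modify_empty`).
[cite: Howard2004HeegnerKolyvagin, Def. 1.2.2 (arXiv Def. 2.2.2, p. 6 L101–125)] -/
theorem atLevel_empty_cond (ρ : DiscreteGaloisModule K M) (t : SelmerTriple p ρ) (jbar : AlgebraicClosure K →+* ℂ) :
    (t.atLevel jbar ∅).cond = t.cond := by
  change t.cond.modify (transverseStructure p ρ jbar) ∅ ∅ ∅ = _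
  exact SelmerStructure.modify_empty _ _

end SelmerTriple

/-! ## §1 The engine instantiated: `κ^{(k)}_n ∈ Stub^{(k)}(n)` on `𝓝(𝓛^{(2k-1)})` -/

namespace DVRSetting

variable {p : ℕ} [Fact p.Prime] {K : Type} [Field K] [NumberField K]
  {R : Type} [CommRing R] [IsDomain R] [IsDiscreteValuationRing R] [Algebra ℤ_[p] R]
  {N : ℕ → Type} [∀ k, AddCommGroup (N k)] [∀ k, TopologicalSpace (N k)]
  [∀ k, DiscreteTopology (N k)] [∀ k, Module R (N k)]
  {Rk : ℕ → Type} [∀ k, CommRing (Rk k)] [∀ k, IsLocalRing (Rk k)] [∀ k, TopologicalSpace (Rk k)]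
  [∀ k, DiscreteTopology (Rk k)] [∀ k, Algebra ℤ_[p] (Rk k)] [∀ k, Algebra R (Rk k)]
  [∀ k, Module (Rk k) (N k)] [∀ k, IsScalarTower R (Rk k) (N k)]
  {Nbar : Type} [AddCommGroup Nbar] [TopologicalSpace Nbar] [DiscreteTopology Nbar]
  [∀ k, Module (Rk k) Nbar]
  {Nq : ℕ → Finset (HeightOneSpectrum (𝓞 K)) → Type} [∀ k n, AddCommGroup (Nq k n)]
  [∀ k n, TopologicalSpace (Nq k n)] [∀ k n, DiscreteTopology (Nq k n)]
  [∀ k n, Module (Rk k) (Nq k n)] [∀ k n, Module R (Nq k n)]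
  [∀ k n, IsScalarTower R (Rk k) (Nq k n)]

/-- **Howard's Lemma 1.6.4 on a `DVRSetting`, the ENGINE instantiated: `κ^{(k)}_n ∈ Stub^{(k)}(n)` for every level `k`
and every `n ∈ 𝓝(𝓛^{(2k-1)})`**, from the printed inputs in the cell's data currency — `hlam` (the liftability-case
bookkeeping), `hlift` (Lemma 1.6.3 + liftability), `hKS` (the Kolyvagin relations), `h159` (Prop. 1.5.9), `hsmall`
(«ρ(n) ≤ 1 ⇒ Stub = H»), `hchebI`/`hchebII` (Lemma 1.6.2 + Lemma 1.5.3) for eigen-counts `ρp ρm` — the binders of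
`mem_stub_of_stubLemmaInduction_levels_guarded` with `P := enginePrimes`, `ϖ := π`, `κ := kappaSel`, `Stub := stub`,
`loc := locR` restricted, `red := redSel`, the level-of-vanishing letter `lam` a parameter (on full settings the
cell reads `lam k n := stubLength k n - 1`, the level carrying `T/π^{λ}T`); `hP`, `hred`, `htors` discharged.
[cite: Howard2004HeegnerKolyvagin, Lemma 1.6.4 (arXiv Lemma 2.6.4, p. 11 L82 – p. 12 L27)] -/
theorem kappaSel_mem_stub_of_engineInputs (S : DVRSetting p K R N Rk Nbar Nq) (hy : S.SatisfiesH)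
    (κ : S.KolyvaginSystem) (pins : ∀ v : HeightOneSpectrum (𝓞 K), TamePin v) (hdec : S.HasLevelDecompositions hy)
    (ρp ρm lam : ℕ → Finset (HeightOneSpectrum (𝓞 K)) → ℕ) :
    letI : ∀ k, Module R (galoisCohomology (S.T.ρ k) 1) := fun k => galoisCohomology.moduleH1 (S.T.ρ k) (S.T.hlin k)
    letI : ∀ (k : ℕ) (v : Place K), Module R (galoisCohomology ((S.T.ρ k).toLocal v) 1) :=
      fun k v => galoisCohomology.moduleH1 ((S.T.ρ k).toLocal v) ((S.T.hlin k).restrictField (Place.Completion v))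
    (∀ k n, ↑n ⊆ S.enginePrimes k → S.stub hy hdec k n ≠ ⊥ →
        S.stub hy hdec k n = ⊤ ∨ (lam k n < k ∧ S.stub hy hdec (lam k n) n = ⊥)) →
    (∀ k n, ↑n ⊆ S.enginePrimes k → S.stub hy hdec k n ≠ ⊥ → S.stub hy hdec k n ≠ ⊤ →
        S.redSel hy k (lam k n) n (S.kappaSel hy κ pins k n) = 0 →
          S.kappaSel hy κ pins k n ∈ S.stub hy hdec k n) →
    (∀ k n (ℓ : HeightOneSpectrum (𝓞 K)), ↑n ⊆ S.enginePrimes k → ℓ ∈ S.enginePrimes k → ℓ ∉ n →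
        ((S.locR k (Sum.inr ℓ)).domRestrict (S.selmerModuleAt hy k n) (S.kappaSel hy κ pins k n) = 0 ↔
          (S.locR k (Sum.inr ℓ)).domRestrict (S.selmerModuleAt hy k (insert ℓ n))
            (S.kappaSel hy κ pins k (insert ℓ n)) = 0)) →
    (∀ k n (ℓ : HeightOneSpectrum (𝓞 K)), ↑n ⊆ S.enginePrimes k → ℓ ∈ S.enginePrimes k → ℓ ∉ n →
        S.stub hy hdec k n ≤ LinearMap.ker ((S.locR k (Sum.inr ℓ)).domRestrict (S.selmerModuleAt hy k n)) →
          S.stub hy hdec k (insert ℓ n) ≤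
            LinearMap.ker ((S.locR k (Sum.inr ℓ)).domRestrict (S.selmerModuleAt hy k (insert ℓ n)))) →
    (∀ k n, ↑n ⊆ S.enginePrimes k → ρp k n + ρm k n ≤ 1 → S.stub hy hdec k n = ⊤) →
    (∀ k n, ↑n ⊆ S.enginePrimes k → 0 < ρp k n → 0 < ρm k n → ∀ d : ↥(S.selmerModuleAt hy k n), d ≠ 0 →
        S.π • d = 0 → ∃ ℓ ∈ S.enginePrimes k, ℓ ∉ n ∧
          (S.locR k (Sum.inr ℓ)).domRestrict (S.selmerModuleAt hy k n) d ≠ 0 ∧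
            ρp k (insert ℓ n) + 1 = ρp k n ∧ ρm k (insert ℓ n) + 1 = ρm k n) →
    (∀ k n, ↑n ⊆ S.enginePrimes k → (ρm k n = 0 ∧ 2 ≤ ρp k n) ∨ (ρp k n = 0 ∧ 2 ≤ ρm k n) →
        ∀ d : ↥(S.selmerModuleAt hy k n), d ≠ 0 → S.π • d = 0 →
          ∃ ℓ ∈ S.enginePrimes k, ℓ ∉ n ∧ (S.locR k (Sum.inr ℓ)).domRestrict (S.selmerModuleAt hy k n) d ≠ 0 ∧
            0 < ρp k (insert ℓ n) ∧ 0 < ρm k (insert ℓ n) ∧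
              ρp k (insert ℓ n) + ρm k (insert ℓ n) = ρp k n + ρm k n) →
    ∀ (k : ℕ) (n : Finset (HeightOneSpectrum (𝓞 K))), ↑n ⊆ S.enginePrimes k →
      S.kappaSel hy κ pins k n ∈ S.stub hy hdec k n := by
  letI : ∀ k, Module R (galoisCohomology (S.T.ρ k) 1) := fun k => galoisCohomology.moduleH1 (S.T.ρ k) (S.T.hlin k)
  letI : ∀ (k : ℕ) (v : Place K), Module R (galoisCohomology ((S.T.ρ k).toLocal v) 1) :=
    fun k v => galoisCohomology.moduleH1 ((S.T.ρ k).toLocal v) ((S.T.hlin k).restrictField (Place.Completion v))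
  intro hlam hlift hKS h159 hsmall hchebI hchebII k n hn
  exact mem_stub_of_stubLemmaInduction_levels_guarded (ι := HeightOneSpectrum (𝓞 K))
    (H := fun k n => ↥(S.selmerModuleAt hy k n))
    (L := fun k _ ℓ => galoisCohomology ((S.T.ρ k).toLocal (Sum.inr ℓ)) 1)
    S.enginePrimes S.π (S.kappaSel hy κ pins) (S.stub hy hdec) lam ρp ρm
    (fun k n ℓ => (S.locR k (Sum.inr ℓ)).domRestrict (S.selmerModuleAt hy k n)) (S.redSel hy)
    (fun i k h => S.enginePrimes_antitone hy h) hlam (S.hred_kappaSel hy κ pins) hlift hKS h159 hsmall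
    (fun k n x => S.exists_pow_smul_eq_zero_selmerModuleAt hy k n x) hchebI hchebII k n hn

/-! ## §2 The empty level: `κ^{(k)}_1 = κ_1^{(k)}`, `F(1) = F`, the chosen decompositions, Lemma 1.6.4 at `n = 1` -/

/-- `1 ∈ 𝓝(𝓛^{(2k-1)})`: the empty level is a level of every prime set. [cite: Howard2004HeegnerKolyvagin, §1.2 (arXiv p. 6, L98–100)] -/
theorem empty_subset_enginePrimes (S : DVRSetting p K R N Rk Nbar Nq) (k : ℕ) :
    ↑(∅ : Finset (HeightOneSpectrum (𝓞 K))) ⊆ S.enginePrimes k := by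
  rw [Finset.coe_empty]
  exact Set.empty_subset _

/-- **`κ^{(k)}_1` read in `H¹(K, T^{(k)})` is the bottom class `κ_1^{(k)}`**: `κ_one` says
`κ k ∅ = H¹(π_∅)(κ_1^{(k)}) ⊗ 1` with `1 ∈ G_1 = ℤ` the empty tensor `⊗_{q ∈ ∅} ḡ_q`, and the de-tensored class is
unique (`eq_kappaR_of_tmul_eq`; `ker π_∅ = 0`). [cite: Howard2004HeegnerKolyvagin, Def. 1.2.3 and Lemma 1.6.4 (arXiv p. 7 L1–12, p. 12 L29–33: «in particular `κ_1 ∈ 𝔪^{λ} H¹_F(K,T^{(k)})`»)] -/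
theorem kappaR_empty (S : DVRSetting p K R N Rk Nbar Nq) (hy : S.SatisfiesH) (κ : S.KolyvaginSystem)
    (pins : ∀ v : HeightOneSpectrum (𝓞 K), TamePin v) (k : ℕ) : S.kappaR κ pins k ∅ = κ.one k := by
  have hker := S.ker_π_eq_bot_of_subset_enginePrimes hy k (S.empty_subset_enginePrimes k)
  have hlev := S.mem_levelSet_of_subset_enginePrimes hy k k (S.empty_subset_enginePrimes k)
  haveI : IsEmpty (↥(∅ : Finset (HeightOneSpectrum (𝓞 K)))) := ⟨fun x => Finset.notMem_empty _ x.2⟩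
  have h1 : (gnEmptyEquiv (K := K)).symm 1 =
      (PiTensorProduct.tprod ℤ fun q : ↥(∅ : Finset (HeightOneSpectrum (𝓞 K))) => (pins q).gbar :
        Gn (K := K) ∅) := by
    rw [LinearEquiv.symm_apply_eq]
    exact (PiTensorProduct.isEmptyEquiv_apply_tprod (ι := ↥(∅ : Finset (HeightOneSpectrum (𝓞 K)))) _).symm
  have h := κ.κ_one k
  rw [h1] at h
  exact (S.eq_kappaR_of_tmul_eq κ pins k hker hlev h).symm

/-- `κ k 1 = κ_1^{(k)}` for the engine's letter `kappaSel`. [cite: Howard2004HeegnerKolyvagin, Def. 1.2.3 (arXiv p. 7 L1–12)] -/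
theorem coe_kappaSel_empty (S : DVRSetting p K R N Rk Nbar Nq) (hy : S.SatisfiesH) (κ : S.KolyvaginSystem)
    (pins : ∀ v : HeightOneSpectrum (𝓞 K), TamePin v) (k : ℕ) :
    (S.kappaSel hy κ pins k ∅ : galoisCohomology (S.T.ρ k) 1) = κ.one k := by
  rw [coe_kappaSel]
  exact S.kappaR_empty hy κ pins k

/-- **`H¹_{F(1)}(K, T^{(k)}) = H¹_F(K, T^{(k)})`** (the Selmer groups, from `F(1) = F`).
[cite: Howard2004HeegnerKolyvagin, Def. 1.2.2 (arXiv p. 6 L101–125)] -/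
theorem selmerGroup_atLevel_empty (S : DVRSetting p K R N Rk Nbar Nq) (k : ℕ) :
    (((S.t k).atLevel S.jbar ∅).cond).selmerGroup = ((S.t k).cond).selmerGroup := by
  rw [SelmerTriple.atLevel_empty_cond]

/-- **Transport of an `R`-equivariant decomposition of `H¹_{F(1)}(K, T^{(k)})` to one of `H¹_F(K, T^{(k)})`** (same
`ε`, same `M`) along `F(1) = F`. [cite: Howard2004HeegnerKolyvagin, Thm. 1.4.2 at (T^{(k)}, F) (arXiv p. 8 L99–105, p. 11 L38–44)] -/
theorem exists_dec_cond_of_dec_atLevel_empty (S : DVRSetting p K R N Rk Nbar Nq) (hy : S.SatisfiesH) (k : ℕ)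
    {ε : ℕ} {M : Type} [AddCommGroup M] [Module R M]
    (θ₀ : ↥((((S.t k).atLevel S.jbar ∅).cond).selmerGroup) ≃+
      ((Fin ε → R ⧸ IsLocalRing.maximalIdeal R ^ S.e k) × (M × M)))
    (hθ₀ : ∀ (r : R) (y : galoisCohomology (S.T.ρ k) 1) (hy' : y ∈ (((S.t k).atLevel S.jbar ∅).cond).selmerGroup),
      θ₀ ⟨galoisCohomology.scalarMapH1 (S.T.ρ k) (S.T.hlin k) r y,
          S.scalarMapH1_mem_selmerGroup_atLevel hy k ∅ r hy'⟩ = r • θ₀ ⟨y, hy'⟩) :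
    ∃ θ : ↥(((S.t k).cond).selmerGroup) ≃+ ((Fin ε → R ⧸ IsLocalRing.maximalIdeal R ^ S.e k) × (M × M)),
      ∀ (r : R) (y : galoisCohomology (S.T.ρ k) 1) (hy' : y ∈ ((S.t k).cond).selmerGroup),
        θ ⟨galoisCohomology.scalarMapH1 (S.T.ρ k) (S.T.hlin k) r y,
            S.scalarMapH1_mem_selmerGroup hy k r hy'⟩ = r • θ ⟨y, hy'⟩ := by
  have hSG : ((S.t k).cond).selmerGroup = (((S.t k).atLevel S.jbar ∅).cond).selmerGroup :=
    (S.selmerGroup_atLevel_empty k).symm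
  refine ⟨(AddEquiv.addSubgroupCongr hSG).trans θ₀, fun r y hy' => ?_⟩
  exact hθ₀ r y (hSG ▸ hy')

/-- **The CHOSEN decomposition behind `λ^{(k)}(n)`**: for `n ∈ 𝓝(𝓛^{(2k-1)})` there is an `R`-equivariant
decomposition `H¹_{F(n)}(K, T^{(k)}) ≃ (Fin ε → R/𝔪^{e_k}) × (M × M)` with `stubLength k n = len_R M` (the one
`stubLength` chose). [cite: Howard2004HeegnerKolyvagin, Def. 1.5.4 (arXiv Def. 2.5.4, p. 10 L56–58)] -/
theorem exists_dec_stubLength_eq (S : DVRSetting p K R N Rk Nbar Nq) (hy : S.SatisfiesH)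
    (hdec : S.HasLevelDecompositions hy) (k : ℕ) {n : Finset (HeightOneSpectrum (𝓞 K))}
    (hn : ↑n ⊆ S.enginePrimes k) :
    ∃ (ε : ℕ) (_ : ε ≤ 1) (M : Type) (_ : AddCommGroup M) (_ : Module R M) (_ : Finite M)
      (θ : ↥((((S.t k).atLevel S.jbar n).cond).selmerGroup) ≃+
        ((Fin ε → R ⧸ IsLocalRing.maximalIdeal R ^ S.e k) × (M × M))),
      (∀ (r : R) (y : galoisCohomology (S.T.ρ k) 1) (hy' : y ∈ (((S.t k).atLevel S.jbar n).cond).selmerGroup),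
        θ ⟨galoisCohomology.scalarMapH1 (S.T.ρ k) (S.T.hlin k) r y,
            S.scalarMapH1_mem_selmerGroup_atLevel hy k n r hy'⟩ = r • θ ⟨y, hy'⟩) ∧
      S.stubLength hy hdec k n = (Module.length R M).toNat := by
  unfold stubLength
  rw [dif_pos hn]
  -- the witnesses are the choices made by `stubLength` itself, so the length clause is `rfl`
  exact ⟨_, Classical.choose (Classical.choose_spec (hdec k n hn)), _, _, _,
    Classical.choose (Classical.choose_spec (Classical.choose_spec (Classical.choose_spec (Classical.choose_spec
      (Classical.choose_spec (hdec k n hn)))))), _,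
    Classical.choose_spec (Classical.choose_spec (Classical.choose_spec (Classical.choose_spec (Classical.choose_spec
      (Classical.choose_spec (Classical.choose_spec (hdec k n hn))))))), rfl⟩

/-- **Lemma 1.6.4 at `n = 1`** («in particular `κ_1 ∈ 𝔪^{λ^{(k)}} H¹_F(K, T^{(k)})` for every `k`»): from the
engine's output at the empty level, `κ^{(k)}_1 ∈ Stub^{(k)}(1)`, a Selmer class `y ∈ H¹_F(K, T^{(k)})` with
`κ_1^{(k)} = π^{λ^{(k)}(1)} · y` (`λ^{(k)}(1) = stubLength k ∅`; `F(1) = F`, `κ^{(k)}_1 = κ_1^{(k)}`).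
[cite: Howard2004HeegnerKolyvagin, Lemma 1.6.4 and the end of the proof of Thm. 1.6.1 (arXiv p. 11 L82–84, p. 12 L29–33)] -/
theorem exists_one_eq_scalarMapH1_of_kappaSel_empty_mem_stub (S : DVRSetting p K R N Rk Nbar Nq) (hy : S.SatisfiesH)
    (κ : S.KolyvaginSystem) (pins : ∀ v : HeightOneSpectrum (𝓞 K), TamePin v) (hdec : S.HasLevelDecompositions hy)
    (k : ℕ) (hmem : S.kappaSel hy κ pins k ∅ ∈ S.stub hy hdec k ∅) :
    ∃ y ∈ ((S.t k).cond).selmerGroup,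
      κ.one k = galoisCohomology.scalarMapH1 (S.T.ρ k) (S.T.hlin k) (S.π ^ S.stubLength hy hdec k ∅) y := by
  letI := galoisCohomology.moduleH1 (S.T.ρ k) (S.T.hlin k)
  obtain ⟨y, hy'⟩ := (S.mem_stub_iff hy hdec k ∅ _).mp hmem
  refine ⟨(y : galoisCohomology (S.T.ρ k) 1), ?_, ?_⟩
  · rw [← S.selmerGroup_atLevel_empty k]
    exact y.2
  · have h := congrArg Subtype.val hy'
    rw [S.coe_kappaSel_empty hy κ pins k] at h
    exact h.symm

/-! ## §3 Thm. 1.6.1's conclusion for `S` from the engine inputs -/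

/-- **Thm. 1.6.1's conclusion record from `∀ k, κ^{(k)}_1 ∈ Stub^{(k)}(1)`** (the engine's output at the empty
level) on a `DVRSetting` with H.0–H.5, levelwise decompositions and `κ_1 ≠ 0`: the CHOSEN decompositions at `n = 1`
(those behind `λ^{(k)}(1)`), transported along `F(1) = F`, form a per-level package with `λ^{(k)}(1) = len_R M_k`, and
Lemma 1.6.4 at `n = 1` (`exists_one_eq_scalarMapH1_of_kappaSel_empty_mem_stub`) is its `h164` clause; then the package
route `conclusion_of_levelwise_package` («`ε` is independent of `k`» derived there).
[cite: Howard2004HeegnerKolyvagin, Thm. 1.6.1, proof (arXiv p. 11 L33–44; p. 12 L29–55)] -/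
theorem conclusion_of_kappaSel_empty_mem_stub (S : DVRSetting p K R N Rk Nbar Nq) (hy : S.SatisfiesH)
    (κ : S.KolyvaginSystem) (pins : ∀ v : HeightOneSpectrum (𝓞 K), TamePin v) (hdec : S.HasLevelDecompositions hy)
    (hmem : ∀ k, S.kappaSel hy κ pins k ∅ ∈ S.stub hy hdec k ∅) (hone : κ.one ≠ 0) : S.Conclusion hy κ.one := by
  choose ε hε M i₁ i₂ i₃ θ₀ hθ₀ hlen using
    fun k => S.exists_dec_stubLength_eq hy hdec k (S.empty_subset_enginePrimes k)
  choose θ hθ using fun k => S.exists_dec_cond_of_dec_atLevel_empty hy k (θ₀ k) (hθ₀ k)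
  refine S.conclusion_of_levelwise_package κ hy hε θ hθ (fun k => ?_) hone
  rw [← hlen k]
  exact S.exists_one_eq_scalarMapH1_of_kappaSel_empty_mem_stub hy κ pins hdec k (hmem k)

/-- **Howard's Thm. 1.6.1 — the conclusion record `S.Conclusion hy κ.one` — for a `DVRSetting` with H.0–H.5 and
`κ_1 ≠ 0, from the levelwise structure (`HasLevelDecompositions`, Thm. 1.4.2 / Prop. 1.4.1 as applied) and the
ENGINE INPUTS in the cell's data currency** (`hlam`, `hlift`, `hKS`, `h159`, `hsmall`, `hchebI`, `hchebII` for
eigen-counts `ρp ρm` and a level-of-vanishing letter `lam`): §1 (Lemma 1.6.4 on every `𝓝(𝓛^{(2k-1)})`) at the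
empty level, §2 (`κ^{(k)}_1 = κ_1^{(k)}`, `F(1) = F`, the chosen decompositions with `λ^{(k)}(1) = len M_k`), then the
package route `conclusion_of_levelwise_package` («`ε` is independent of `k`» derived there).  `thm161_dvrKolyvaginBound`
is NOT proved here: the engine inputs remain hypotheses.
[cite: Howard2004HeegnerKolyvagin, Thm. 1.6.1 and its proof (arXiv Thm. 2.6.1, p. 11 L23–28, L33–44; Lemma 2.6.4, p. 11 L82 – p. 12 L33)] -/
theorem conclusion_of_engineInputs (S : DVRSetting p K R N Rk Nbar Nq) (hy : S.SatisfiesH)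
    (κ : S.KolyvaginSystem) (pins : ∀ v : HeightOneSpectrum (𝓞 K), TamePin v) (hdec : S.HasLevelDecompositions hy)
    (ρp ρm lam : ℕ → Finset (HeightOneSpectrum (𝓞 K)) → ℕ) :
    letI : ∀ k, Module R (galoisCohomology (S.T.ρ k) 1) := fun k => galoisCohomology.moduleH1 (S.T.ρ k) (S.T.hlin k)
    letI : ∀ (k : ℕ) (v : Place K), Module R (galoisCohomology ((S.T.ρ k).toLocal v) 1) :=
      fun k v => galoisCohomology.moduleH1 ((S.T.ρ k).toLocal v) ((S.T.hlin k).restrictField (Place.Completion v))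
    (∀ k n, ↑n ⊆ S.enginePrimes k → S.stub hy hdec k n ≠ ⊥ →
        S.stub hy hdec k n = ⊤ ∨ (lam k n < k ∧ S.stub hy hdec (lam k n) n = ⊥)) →
    (∀ k n, ↑n ⊆ S.enginePrimes k → S.stub hy hdec k n ≠ ⊥ → S.stub hy hdec k n ≠ ⊤ →
        S.redSel hy k (lam k n) n (S.kappaSel hy κ pins k n) = 0 →
          S.kappaSel hy κ pins k n ∈ S.stub hy hdec k n) →
    (∀ k n (ℓ : HeightOneSpectrum (𝓞 K)), ↑n ⊆ S.enginePrimes k → ℓ ∈ S.enginePrimes k → ℓ ∉ n →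
        ((S.locR k (Sum.inr ℓ)).domRestrict (S.selmerModuleAt hy k n) (S.kappaSel hy κ pins k n) = 0 ↔
          (S.locR k (Sum.inr ℓ)).domRestrict (S.selmerModuleAt hy k (insert ℓ n))
            (S.kappaSel hy κ pins k (insert ℓ n)) = 0)) →
    (∀ k n (ℓ : HeightOneSpectrum (𝓞 K)), ↑n ⊆ S.enginePrimes k → ℓ ∈ S.enginePrimes k → ℓ ∉ n →
        S.stub hy hdec k n ≤ LinearMap.ker ((S.locR k (Sum.inr ℓ)).domRestrict (S.selmerModuleAt hy k n)) →
          S.stub hy hdec k (insert ℓ n) ≤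
            LinearMap.ker ((S.locR k (Sum.inr ℓ)).domRestrict (S.selmerModuleAt hy k (insert ℓ n)))) →
    (∀ k n, ↑n ⊆ S.enginePrimes k → ρp k n + ρm k n ≤ 1 → S.stub hy hdec k n = ⊤) →
    (∀ k n, ↑n ⊆ S.enginePrimes k → 0 < ρp k n → 0 < ρm k n → ∀ d : ↥(S.selmerModuleAt hy k n), d ≠ 0 →
        S.π • d = 0 → ∃ ℓ ∈ S.enginePrimes k, ℓ ∉ n ∧
          (S.locR k (Sum.inr ℓ)).domRestrict (S.selmerModuleAt hy k n) d ≠ 0 ∧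
            ρp k (insert ℓ n) + 1 = ρp k n ∧ ρm k (insert ℓ n) + 1 = ρm k n) →
    (∀ k n, ↑n ⊆ S.enginePrimes k → (ρm k n = 0 ∧ 2 ≤ ρp k n) ∨ (ρp k n = 0 ∧ 2 ≤ ρm k n) →
        ∀ d : ↥(S.selmerModuleAt hy k n), d ≠ 0 → S.π • d = 0 →
          ∃ ℓ ∈ S.enginePrimes k, ℓ ∉ n ∧ (S.locR k (Sum.inr ℓ)).domRestrict (S.selmerModuleAt hy k n) d ≠ 0 ∧
            0 < ρp k (insert ℓ n) ∧ 0 < ρm k (insert ℓ n) ∧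
              ρp k (insert ℓ n) + ρm k (insert ℓ n) = ρp k n + ρm k n) →
    κ.one ≠ 0 → S.Conclusion hy κ.one := by
  letI : ∀ k, Module R (galoisCohomology (S.T.ρ k) 1) := fun k => galoisCohomology.moduleH1 (S.T.ρ k) (S.T.hlin k)
  letI : ∀ (k : ℕ) (v : Place K), Module R (galoisCohomology ((S.T.ρ k).toLocal v) 1) :=
    fun k v => galoisCohomology.moduleH1 ((S.T.ρ k).toLocal v) ((S.T.hlin k).restrictField (Place.Completion v))
  intro hlam hlift hKS h159 hsmall hchebI hchebII hone
  exact S.conclusion_of_kappaSel_empty_mem_stub hy κ pins hdec (fun k =>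
    S.kappaSel_mem_stub_of_engineInputs hy κ pins hdec ρp ρm lam hlam hlift hKS h159 hsmall hchebI hchebII k ∅
      (S.empty_subset_enginePrimes k)) hone

end DVRSetting

end Literature.NumberTheory.GaloisCohomology.Howard2004

end
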